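import Literature.Computability.AlgebraicComplexity.AsymptoticRankConjecture
import Literature.Computability.AlgebraicComplexity.AsymptoticRankMatMul
import Literature.Computability.AlgebraicComplexity.TensorRestrictionRank
import Literature.Computability.AlgebraicComplexity.FlatteningBound
import HarnessLib

/-!
# `⟨k,m,n⟩` is concise and tight; Strassen's asymptotic rank conjecture implies `ω = 2` (proved)

Topic `Literature/Computability/AlgebraicComplexity` (family `MatrixMultiplication`). The printed
implication "Conjecture 1.4 ⇒ Conjecture 1.3" of A. Conner, F. Gesmundo, J. M. Landsberg,
E. Ventura, Y. Wang, *Towards a geometric approach to Strassen's asymptotic rank conjecture*,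
Collect. Math. 72 (2021) = arXiv:1811.05511, §1.2: Strassen's asymptotic rank conjecture
(Conj. 1.4, the tree's `StrassenAsymptoticRankConjecture`: every concise tight
`T ∈ ℂ^m ⊗ ℂ^m ⊗ ℂ^m` has `R̃(T) = m`) implies Conj. 1.3 ("`R̃(M_⟨n⟩) = n²`, i.e., `M_⟨n⟩` has minimal
asymptotic rank"), which is `ω = 2` — because "`M_⟨n⟩` is tight" (ibid., §1.2) and matrix tensors
are concise (Bürgisser–Clausen–Shokrollahi 1997, proof of (15.12), p. 387: "Matrix tensors are
concise"; Rem. (15.35)(3), p. 396: "The support of a matrix tensor `⟨e, h, ℓ⟩` is tight"; §15.13,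
p. 422: "Strassen's conjecture implies that `ω(k) = 2`").

Proved here, in the tree's vocabulary (`matMulTensor`, `IsConcise`, `IsTightSet`/`IsTight`,
`asymptoticRank`, `omega`):

* `isConcise_matMulTensor` — `⟨k,m,n⟩` is concise over any field (`k, m, n ≥ 1`): the slice of
  index `(κ,ν)` is the only one with a non-zero entry at the dual point `((κ,0),(0,ν))`, and
  similarly in the other two legs (`linearIndependent_of_dualPoints`). (The tree already had the
  cubic case over `ℂ` in the form `concise_matMulTensor_fst/snd/thd`, `MatMulPolystableProofs.lean`;
  not imported, being a heavier module.)
* `isTightSet_tensorSupport_matMulTensor`, `isTight_matMulTensor` — BCS Rem. (15.35)(3): with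
  `R = k + m + 1` the injective labels `τ_A(κ,ν) = R(κ + Rν)`, `τ_B(κ',μ) = μ − Rκ'`,
  `τ_C(μ',ν') = −(μ' + R²ν')` sum to `0` on the support `κ = κ'`, `μ = μ'`, `ν = ν'`.
* transport along bijections of the index sets: `IsConcise.reindex`,
  `isTightSet_tensorSupport_reindex`, `asymptoticRank_reindex` (restriction both ways,
  `tensorRestrictsTo_precomp` / `tensorRestrictsTo_of_reindex`, and monotonicity of `R̃`,
  `asymptoticRank_le_of_polyDegeneratesTo`).
* `StrassenAsymptoticRankConjecture.asymptoticRank_matMul` — under Conj. 1.4, `R̃(⟨q,q,q⟩) = q²`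
  (`⟨q,q,q⟩` reindexed to the cubic format `Fin (q·q)` by `finProdFinEquiv`), i.e. CGLVW Conj. 1.3;
* `StrassenAsymptoticRankConjecture.omega_eq_two` / `.matrixMultiplication` — hence `ω(ℂ) = 2`
  (`R̃(⟨2,2,2⟩) = 2^ω`, `asymptoticRank_matMulTensor`, ADVXXZ 2025 §3.4; and `2 ≤ ω`, `omega_two_le`).

No new definitions, no named facts; the conjecture itself stays an unasserted `Prop`
(`AsymptoticRankConjecture.lean`) and enters only as a hypothesis.

## References

* A. Conner, F. Gesmundo, J. M. Landsberg, E. Ventura, Y. Wang, Collect. Math. 72 (2021) 63–86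
  = arXiv:1811.05511, §1.2 (Conj. 1.3, Conj. 1.4, "`M_⟨n⟩` is tight").
  [ConnerGesmundoLandsbergVenturaWang2020]
* P. Bürgisser, M. Clausen, M. A. Shokrollahi, *Algebraic Complexity Theory* (1997), proof of
  (15.12) p. 387, Def. (15.34) and Rem. (15.35)(3) p. 396, §15.13 p. 422.
  [BurgisserClausenShokrollahi1997]
* J. Alman, R. Duan, V. Vassilevska Williams, Y. Xu, Z. Xu, R. Zhou, SODA 2025 = arXiv:2404.16349,
  §3.4 (`ω = log_q R̃(⟨q,q,q⟩)`). [AlmanDuanVassilevskaWilliamsXuXuZhou2025]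
-/

noncomputable section

open scoped BigOperators

namespace Literature.Computability.AlgebraicComplexity

open Literature.Barriers.MatrixMultiplication (IsConcise asymptoticRank_le_of_polyDegeneratesTo)

/-! ## A dual-point criterion for linear independence -/

section Elementary

/-- **Dual-point criterion for linear independence** of a family of coordinate vectors
`v : ι → (X → K)`: if for every `i` there is a coordinate `x i` at which `v i` is non-zero and all
other `v j` vanish, the family is linearly independent (read a vanishing combination at `x i`).
[folklore] -/
theorem linearIndependent_of_dualPoints {K : Type*} [Field K] {ι X : Type*} [Fintype ι]
    (v : ι → X → K) (x : ι → X) (hdiag : ∀ i, v i (x i) ≠ 0)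
    (hoff : ∀ i j, j ≠ i → v j (x i) = 0) : LinearIndependent K v := by
  rw [Fintype.linearIndependent_iff]
  intro g hg i
  have h := congrFun hg (x i)
  simp only [Finset.sum_apply, Pi.smul_apply, smul_eq_mul, Pi.zero_apply] at h
  rw [Finset.sum_eq_single i (fun j _ hj => by rw [hoff i j hj, mul_zero])
    (fun hi => absurd (Finset.mem_univ i) hi)] at h
  exact (mul_eq_zero.1 h).resolve_right (hdiag i)

end Elementary

/-! ## Relabelling the three index sets along bijections -/

section Reindex

variable {K : Type*} [Field K] {ι κ μ ι' κ' μ' : Type*}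

/-- **Conciseness is invariant under relabelling** the three index sets along bijections: each
slice family of `t ∘ (e₁ × e₂ × e₃)` is the image of the corresponding slice family of `t` under
the (injective) coordinate relabelling, re-indexed by a bijection.
[cite: BlaserLysikov2020, §2.2] -/
theorem _root_.Literature.Barriers.MatrixMultiplication.IsConcise.reindex {t : ι → κ → μ → K}
    (h : IsConcise t) (e₁ : ι' ≃ ι) (e₂ : κ' ≃ κ) (e₃ : μ' ≃ μ) :
    IsConcise (fun a b c => t (e₁ a) (e₂ b) (e₃ c)) := by
  obtain ⟨h₁, h₂, h₃⟩ := h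
  refine ⟨?_, ?_, ?_⟩
  · exact (h₁.map' (LinearMap.funLeft K K (Prod.map e₂ e₃))
      (LinearMap.ker_eq_bot.2 (LinearMap.funLeft_injective_of_surjective K K _
        (e₂.prodCongr e₃).surjective))).comp e₁ e₁.injective
  · exact (h₂.map' (LinearMap.funLeft K K (Prod.map e₁ e₃))
      (LinearMap.ker_eq_bot.2 (LinearMap.funLeft_injective_of_surjective K K _
        (e₁.prodCongr e₃).surjective))).comp e₂ e₂.injective
  · exact (h₃.map' (LinearMap.funLeft K K (Prod.map e₁ e₂))
      (LinearMap.ker_eq_bot.2 (LinearMap.funLeft_injective_of_surjective K K _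
        (e₁.prodCongr e₂).surjective))).comp e₃ e₃.injective

/-- **Tightness of the support is invariant under injective relabelling** (compose the labels
`τ_A, τ_B, τ_C` with the relabelling maps; BCS Rem. (15.35)(2) for the bijective case).
[cite: BurgisserClausenShokrollahi1997, Rem. (15.35)(2)] -/
theorem isTightSet_tensorSupport_reindex [Fintype ι] [Fintype κ] [Fintype μ] [Fintype ι']
    [Fintype κ'] [Fintype μ'] {t : ι → κ → μ → K} (h : IsTightSet (tensorSupport t))
    {f₁ : ι' → ι} {f₂ : κ' → κ} {f₃ : μ' → μ} (hf₁ : Function.Injective f₁)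
    (hf₂ : Function.Injective f₂) (hf₃ : Function.Injective f₃) :
    IsTightSet (tensorSupport fun a b c => t (f₁ a) (f₂ b) (f₃ c)) := by
  obtain ⟨τA, τB, τC, hA, hB, hC, hsum⟩ := h
  exact ⟨τA ∘ f₁, τB ∘ f₂, τC ∘ f₃, hA.comp hf₁, hB.comp hf₂, hC.comp hf₃,
    fun p hp => hsum (f₁ p.1, f₂ p.2.1, f₃ p.2.2) hp⟩

/-- **`R̃` is invariant under relabelling** the index sets along bijections (restriction in both
directions, Bläser 2013 Lemma 5.4, and monotonicity of `R̃`). [cite: Blaser2013, Lemma 5.4] -/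
theorem asymptoticRank_reindex [Fintype ι] [Fintype κ] [Fintype μ] [Fintype ι'] [Fintype κ']
    [Fintype μ'] [DecidableEq ι] [DecidableEq κ] [DecidableEq μ] [DecidableEq ι'] [DecidableEq κ']
    [DecidableEq μ'] (t : ι → κ → μ → K) (e₁ : ι' ≃ ι) (e₂ : κ' ≃ κ) (e₃ : μ' ≃ μ) :
    asymptoticRank (fun a b c => t (e₁ a) (e₂ b) (e₃ c)) = asymptoticRank t :=
  le_antisymm
    (asymptoticRank_le_of_polyDegeneratesTo (tensorRestrictsTo_precomp t e₁ e₂ e₃).polyDegeneratesTo)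
    (asymptoticRank_le_of_polyDegeneratesTo
      (tensorRestrictsTo_of_reindex t e₁ e₂ e₃).polyDegeneratesTo)

end Reindex

/-! ## `⟨k,m,n⟩` is concise and tight -/

section MatMul

variable (K : Type*) [Field K]

/-- **Matrix tensors are concise** (BCS 1997, proof of (15.12): "Matrix tensors are concise";
Bläser–Lysikov 2020 §2.2 for the notion): for `k, m, n ≥ 1` the three slice families of
`⟨k,m,n⟩` are linearly independent — the slice of index `(κ,ν)` (resp. `(κ',μ)`, `(μ',ν')`) is the
only one with a non-zero entry at `((κ,0),(0,ν))` (resp. `((κ',0),(μ,0))`, `((0,ν'),(0,μ'))`).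
[cite: BurgisserClausenShokrollahi1997, (15.12) (proof, p. 387)] -/
theorem isConcise_matMulTensor {k m n : ℕ} (hk : 0 < k) (hm : 0 < m) (hn : 0 < n) :
    IsConcise (matMulTensor K k m n) := by
  refine ⟨?_, ?_, ?_⟩
  · refine linearIndependent_of_dualPoints _ (fun a => ((a.1, ⟨0, hm⟩), (⟨0, hm⟩, a.2))) ?_ ?_
    · intro i
      change (if i.1 = i.1 ∧ (⟨0, hm⟩ : Fin m) = ⟨0, hm⟩ ∧ i.2 = i.2 then (1 : K) else 0) ≠ 0
      rw [if_pos ⟨rfl, rfl, rfl⟩]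
      exact one_ne_zero
    · intro i j hne
      change (if j.1 = i.1 ∧ (⟨0, hm⟩ : Fin m) = ⟨0, hm⟩ ∧ j.2 = i.2 then (1 : K) else 0) = 0
      rw [if_neg]
      rintro ⟨h1, -, h3⟩
      exact hne (Prod.ext h1 h3)
  · refine linearIndependent_of_dualPoints _ (fun b => ((b.1, ⟨0, hn⟩), (b.2, ⟨0, hn⟩))) ?_ ?_
    · intro i
      change (if i.1 = i.1 ∧ i.2 = i.2 ∧ (⟨0, hn⟩ : Fin n) = ⟨0, hn⟩ then (1 : K) else 0) ≠ 0
      rw [if_pos ⟨rfl, rfl, rfl⟩]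
      exact one_ne_zero
    · intro i j hne
      change (if i.1 = j.1 ∧ j.2 = i.2 ∧ (⟨0, hn⟩ : Fin n) = ⟨0, hn⟩ then (1 : K) else 0) = 0
      rw [if_neg]
      rintro ⟨h1, h2, -⟩
      exact hne (Prod.ext h1.symm h2)
  · refine linearIndependent_of_dualPoints _ (fun c => ((⟨0, hk⟩, c.2), (⟨0, hk⟩, c.1))) ?_ ?_
    · intro i
      change (if (⟨0, hk⟩ : Fin k) = ⟨0, hk⟩ ∧ i.1 = i.1 ∧ i.2 = i.2 then (1 : K) else 0) ≠ 0
      rw [if_pos ⟨rfl, rfl, rfl⟩]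
      exact one_ne_zero
    · intro i j hne
      change (if (⟨0, hk⟩ : Fin k) = ⟨0, hk⟩ ∧ i.1 = j.1 ∧ i.2 = j.2 then (1 : K) else 0) = 0
      rw [if_neg]
      rintro ⟨-, h2, h3⟩
      exact hne (Prod.ext h2.symm h3.symm)

/-- **The support of a matrix tensor is tight** (BCS 1997, Rem. (15.35)(3); CGLVW 2021 §1.2:
"`M_⟨n⟩` is tight"): with `R = k + m + 1`, the labels `τ_A(κ,ν) = R(κ + Rν)`,
`τ_B(κ',μ) = μ − Rκ'`, `τ_C(μ',ν') = −(μ' + R²ν')` are injective and sum to `0` on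
`supp ⟨k,m,n⟩ = {((κ,ν),(κ,μ),(μ,ν))}`. [cite: BurgisserClausenShokrollahi1997, Rem. (15.35)(3)] -/
theorem isTightSet_tensorSupport_matMulTensor (k m n : ℕ) :
    IsTightSet (tensorSupport (matMulTensor K k m n)) := by
  set R : ℕ := k + m + 1 with hR
  have hRpos : 0 < R := by omega
  -- mixed-radix digits are unique: remainder and quotient modulo `R`
  have radix : ∀ ⦃a₁ a₂ b₁ b₂ : ℕ⦄, a₁ < R → a₂ < R → a₁ + R * b₁ = a₂ + R * b₂ →
      a₁ = a₂ ∧ b₁ = b₂ := by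
    intro a₁ a₂ b₁ b₂ ha₁ ha₂ h
    have u₁ : (a₁ + R * b₁) / R = b₁ ∧ (a₁ + R * b₁) % R = a₁ :=
      (Nat.div_mod_unique hRpos).mpr ⟨rfl, ha₁⟩
    have u₂ : (a₂ + R * b₂) / R = b₂ ∧ (a₂ + R * b₂) % R = a₂ :=
      (Nat.div_mod_unique hRpos).mpr ⟨rfl, ha₂⟩
    rw [h] at u₁
    exact ⟨u₁.2.symm.trans u₂.2, u₁.1.symm.trans u₂.1⟩
  refine ⟨fun a => ((R * ((a.1 : ℕ) + R * (a.2 : ℕ)) : ℕ) : ℤ),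
    fun b => ((b.2 : ℕ) : ℤ) - ((R * (b.1 : ℕ) : ℕ) : ℤ),
    fun c => -((((c.1 : ℕ) + R * (R * (c.2 : ℕ)) : ℕ) : ℤ)), ?_, ?_, ?_, ?_⟩
  · rintro ⟨κ₁, ν₁⟩ ⟨κ₂, ν₂⟩ h
    dsimp only at h
    have h' : (κ₁ : ℕ) + R * ν₁ = κ₂ + R * ν₂ :=
      Nat.eq_of_mul_eq_mul_left hRpos (by exact_mod_cast h)
    obtain ⟨h1, h2⟩ := radix (lt_of_lt_of_le κ₁.isLt (by omega))
      (lt_of_lt_of_le κ₂.isLt (by omega)) h'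
    exact Prod.ext (Fin.ext h1) (Fin.ext h2)
  · rintro ⟨κ₁, μ₁⟩ ⟨κ₂, μ₂⟩ h
    dsimp only at h
    have h2 : ((μ₁ : ℕ) : ℤ) + (R : ℤ) * (κ₂ : ℕ) = (μ₂ : ℕ) + (R : ℤ) * (κ₁ : ℕ) := by
      push_cast at h
      linarith
    have h3 : (μ₁ : ℕ) + R * κ₂ = μ₂ + R * κ₁ := by exact_mod_cast h2
    obtain ⟨e1, e2⟩ := radix (lt_of_lt_of_le μ₁.isLt (by omega))
      (lt_of_lt_of_le μ₂.isLt (by omega)) h3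
    exact Prod.ext (Fin.ext e2.symm) (Fin.ext e1)
  · rintro ⟨μ₁, ν₁⟩ ⟨μ₂, ν₂⟩ h
    dsimp only at h
    have h2 : (μ₁ : ℕ) + R * (R * ν₁) = μ₂ + R * (R * ν₂) := by exact_mod_cast neg_injective h
    obtain ⟨e1, e2⟩ := radix (lt_of_lt_of_le μ₁.isLt (by omega))
      (lt_of_lt_of_le μ₂.isLt (by omega)) h2
    exact Prod.ext (Fin.ext e1) (Fin.ext (Nat.eq_of_mul_eq_mul_left hRpos e2))
  · rintro ⟨⟨κ, ν⟩, ⟨κ', μ⟩, ⟨μ', ν'⟩⟩ hp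
    have hp' : κ = κ' ∧ μ = μ' ∧ ν = ν' := by
      by_contra hcon
      exact hp (if_neg hcon)
    obtain ⟨rfl, rfl, rfl⟩ := hp'
    push_cast
    ring

/-- **`⟨k,m,n⟩` is tight** (in the standard bases; CGLVW 2021 §1.2: "`M_⟨n⟩` is tight").
[cite: ConnerGesmundoLandsbergVenturaWang2020, §1.2] -/
theorem isTight_matMulTensor (k m n : ℕ) : IsTight (matMulTensor K k m n) :=
  IsTight.of_isTightSet (isTightSet_tensorSupport_matMulTensor K k m n)

end MatMul

/-! ## Conjecture 1.4 ⇒ Conjecture 1.3 ⇒ `ω = 2` -/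

section Strassen

/-- **CGLVW 2021, Conj. 1.4 ⇒ Conj. 1.3**: under Strassen's asymptotic rank conjecture,
`R̃(⟨q,q,q⟩) = q²` for every `q ≥ 1` — apply the conjecture with `m = q²` to `⟨q,q,q⟩` relabelled
to the cubic format `Fin (q·q)` (`finProdFinEquiv`), which is concise (`isConcise_matMulTensor`)
and tight (`isTight_matMulTensor`), both properties and `R̃` being invariant under the relabelling.
[cite: ConnerGesmundoLandsbergVenturaWang2020, §1.2 (Conj. 1.4 ⇒ Conj. 1.3)] -/
theorem StrassenAsymptoticRankConjecture.asymptoticRank_matMul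
    (h : StrassenAsymptoticRankConjecture) {q : ℕ} (hq : 1 ≤ q) :
    asymptoticRank (matMulTensor ℂ q q q) = (q : ℝ) ^ 2 := by
  let e : Fin (q * q) ≃ Fin q × Fin q := finProdFinEquiv.symm
  let t' : Fin (q * q) → Fin (q * q) → Fin (q * q) → ℂ :=
    fun a b c => matMulTensor ℂ q q q (e a) (e b) (e c)
  have hc : IsConcise t' := (isConcise_matMulTensor ℂ hq hq hq).reindex e e e
  have ht : IsTight t' :=
    IsTight.of_isTightSet (isTightSet_tensorSupport_reindex
      (isTightSet_tensorSupport_matMulTensor ℂ q q q) e.injective e.injective e.injective)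
  have h1 : asymptoticRank t' = ((q * q : ℕ) : ℝ) := h (q * q) t' hc ht
  have h2 : asymptoticRank t' = asymptoticRank (matMulTensor ℂ q q q) :=
    asymptoticRank_reindex _ e e e
  rw [← h2, h1]
  push_cast
  ring

/-- **Strassen's asymptotic rank conjecture implies `ω(ℂ) = 2`** (CGLVW 2021 §1.2,
"Conjecture 1.4 ⇒ Conjecture 1.3"; BCS 1997 §15.13, p. 422: "Strassen's conjecture implies that
`ω(k) = 2`"): `2^ω = R̃(⟨2,2,2⟩) = 4` (`asymptoticRank_matMulTensor`, ADVXXZ 2025 §3.4) gives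
`ω ≤ 2`, and `2 ≤ ω` is the flattening bound `omega_two_le`.
[cite: ConnerGesmundoLandsbergVenturaWang2020, §1.2 (Conj. 1.4 ⇒ Conj. 1.3)] -/
theorem StrassenAsymptoticRankConjecture.omega_eq_two (h : StrassenAsymptoticRankConjecture) :
    omega ℂ = 2 := by
  refine le_antisymm ?_ (omega_two_le ℂ)
  have h3 : (2 : ℝ) ^ omega ℂ ≤ asymptoticRank (matMulTensor ℂ 2 2 2) := by
    simpa using rpow_omega_le_asymptoticRank_matMulTensor ℂ 2
  have h2 : asymptoticRank (matMulTensor ℂ 2 2 2) = 4 := by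
    have := h.asymptoticRank_matMul (show 1 ≤ 2 by norm_num)
    norm_num at this
    exact this
  have h4 : (2 : ℝ) ^ omega ℂ ≤ (2 : ℝ) ^ (2 : ℝ) := by
    rw [Real.rpow_two]; norm_num; linarith
  exact (Real.rpow_le_rpow_left_iff (by norm_num : (1 : ℝ) < 2)).1 h4

/-- **Strassen's asymptotic rank conjecture implies `MatrixMultiplication`** (`ω(ℂ) = 2`, the
Literature statement `MatrixMultiplication := omega ℂ = 2`).
[cite: ConnerGesmundoLandsbergVenturaWang2020, §1.2 (Conj. 1.4 ⇒ Conj. 1.3)] -/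
theorem StrassenAsymptoticRankConjecture.matrixMultiplication
    (h : StrassenAsymptoticRankConjecture) : MatrixMultiplication :=
  h.omega_eq_two

end Strassen

end Literature.Computability.AlgebraicComplexity

end
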